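import Mathlib
import Summits.Ventures.PercRepro2.TypedStarWorld
import Summits.Ventures.PercRepro2.TypedStarSplit

/-!
# The typed `(2,2,2)`-star base from Harris-cone membership of the core's per-copy pinned table
(blind cell PercRepro2, night-3 g28, 2026-08-29; `proofs/NIGHT3-CERT.md` §37.6)

Let `S = {s₀, s₁, s₂}` be three typed edges of type `2` (a star at an unmarked vertex, or any three edges)
and `F` the other typed edges.  `TypedStarSplit.typedCount_split` writes `typedCount (F ∪ S) z τ K` as the
sum, over the `27` typed assignments of the three edges to the three copies, of the per-copy pinned
counts `T i j k = typedCount3 F (setOn S (cfg i) z) (setOn S (cfg j) z) (setOn S (cfg k) z) τ K`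
(`cfg i` = the star configuration with bits `i`).  The cubic `tableCubic μ = Σ T i j k μ i μ j μ k` on laws
`μ : Fin 8 → ℚ` has `star8 tableCubic = Σ_{typed} T i j k` (the symmetrisation identity of
`TypedStarWorld`), and `star8` is nonnegative on the Harris cone `InCone8`.

THEOREM `typedCount_star222_nonneg`: if `tableCubic` lies in the cone spanned by the cubic monomials in the
`8` star configurations and the pulled-back Harris generators `μ a · hslack s (pushf μ)`, then
`0 ≤ typedCount (F ∪ S) z τ K`.  No connectivity lemma is used: the certificate is read on the
`8³`-state pinned table, which §36.2's gadget law (paper) identifies with the `5³`-state partition table.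
Own work; standard axioms.
-/

namespace Summit.Ventures.PercRepro2

namespace TypedStar

open ThreeTerm

/-- Nesting a conjunction in an `if`. -/
lemma ite_and_left {p q : Prop} [Decidable p] [Decidable q] (x : ℚ) :
    (if p ∧ q then x else 0) = if p then (if q then x else 0) else 0 := by
  split_ifs <;> simp_all

/-! ## The star's configurations as `Fin 8`, and the theorem -/

section Star

variable {E : Type*} [Fintype E] [DecidableEq E] (s0 s1 s2 : E)

/-- The star configuration with bits `i` (`s0` open iff bit `0`, …), closed off the star. -/
def cfg (i : Fin 8) : Config E := fun e =>
  if e = s0 then decide (bit 0 i = 1) else if e = s1 then decide (bit 1 i = 1) else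
    if e = s2 then decide (bit 2 i = 1) else false

/-- The bits of a configuration on the star. -/
def bits (a : Config E) : Fin 8 :=
  ⟨(if a s0 then 1 else 0) + 2 * (if a s1 then 1 else 0) + 4 * (if a s2 then 1 else 0), by
    split_ifs <;> omega⟩

omit [Fintype E] in
/-- Bits are `0` or `1`. -/
lemma bit_le_one (t : ℕ) (i : Fin 8) : bit t i ≤ 1 := by
  unfold bit; exact Nat.le_of_lt_succ (Nat.mod_lt _ (by norm_num))

omit [Fintype E] in
/-- `toNat` of the decided bit is the bit. -/
lemma toNat_decide_bit (t : ℕ) (i : Fin 8) : (decide (bit t i = 1)).toNat = bit t i := by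
  have := bit_le_one t i
  by_cases h : bit t i = 1
  · simp [h]
  · have h0 : bit t i = 0 := by omega
    simp [h0]

variable (h01 : s0 ≠ s1) (h02 : s0 ≠ s2) (h12 : s1 ≠ s2)

omit [Fintype E] in
/-- The star configuration at `s0`. -/
lemma cfg_s0 (i : Fin 8) : cfg s0 s1 s2 i s0 = decide (bit 0 i = 1) := by simp [cfg]

include h01 in
omit [Fintype E] in
/-- The star configuration at `s1`. -/
lemma cfg_s1 (i : Fin 8) : cfg s0 s1 s2 i s1 = decide (bit 1 i = 1) := by simp [cfg, Ne.symm h01]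

include h02 h12 in
omit [Fintype E] in
/-- The star configuration at `s2`. -/
lemma cfg_s2 (i : Fin 8) : cfg s0 s1 s2 i s2 = decide (bit 2 i = 1) := by
  simp [cfg, Ne.symm h02, Ne.symm h12]

omit [Fintype E] in
/-- The star configuration off the star. -/
lemma cfg_other (i : Fin 8) {e : E} (h0 : e ≠ s0) (h1 : e ≠ s1) (h2 : e ≠ s2) :
    cfg s0 s1 s2 i e = false := by simp [cfg, h0, h1, h2]

omit [Fintype E] in
/-- Star configurations are supported on the star. -/
lemma suppOn_cfg (i : Fin 8) : SuppOn {s0, s1, s2} (cfg s0 s1 s2 i) := by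
  intro e he
  by_contra hS
  simp only [Finset.mem_insert, Finset.mem_singleton, not_or] at hS
  rw [cfg_other s0 s1 s2 i hS.1 hS.2.1 hS.2.2] at he
  exact Bool.false_ne_true he

include h01 h02 h12 in
omit [Fintype E] in
/-- `bits ∘ cfg = id`. -/
lemma bits_cfg (i : Fin 8) : bits s0 s1 s2 (cfg s0 s1 s2 i) = i := by
  apply Fin.ext
  simp only [bits, cfg_s0, cfg_s1 s0 s1 s2 h01, cfg_s2 s0 s1 s2 h02 h12]
  have hi := i.isLt
  simp only [bit] at *
  split_ifs <;> simp_all <;> omega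

include h01 h02 h12 in
omit [Fintype E] in
/-- `cfg ∘ bits = id` on configurations supported on the star. -/
lemma cfg_bits {a : Config E} (ha : SuppOn {s0, s1, s2} a) : cfg s0 s1 s2 (bits s0 s1 s2 a) = a := by
  funext e
  by_cases h0 : e = s0
  · rw [h0, cfg_s0]
    simp only [bits, bit]
    rcases Bool.eq_false_or_eq_true (a s0) with hs0 | hs0 <;>
      rcases Bool.eq_false_or_eq_true (a s1) with hs1 | hs1 <;>
      rcases Bool.eq_false_or_eq_true (a s2) with hs2 | hs2 <;> simp [hs0, hs1, hs2]
  by_cases h1 : e = s1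
  · rw [h1, cfg_s1 s0 s1 s2 h01]
    simp only [bits, bit]
    rcases Bool.eq_false_or_eq_true (a s0) with hs0 | hs0 <;>
      rcases Bool.eq_false_or_eq_true (a s1) with hs1 | hs1 <;>
      rcases Bool.eq_false_or_eq_true (a s2) with hs2 | hs2 <;> simp [hs0, hs1, hs2]
  by_cases h2 : e = s2
  · rw [h2, cfg_s2 s0 s1 s2 h02 h12]
    simp only [bits, bit]
    rcases Bool.eq_false_or_eq_true (a s0) with hs0 | hs0 <;>
      rcases Bool.eq_false_or_eq_true (a s1) with hs1 | hs1 <;>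
      rcases Bool.eq_false_or_eq_true (a s2) with hs2 | hs2 <;> simp [hs0, hs1, hs2]
  rw [cfg_other s0 s1 s2 _ h0 h1 h2]
  cases h : a e
  · rfl
  · exact absurd (ha e h) (by simp [h0, h1, h2])

include h01 h02 h12 in
/-- A sum over the configurations supported on the star is a sum over `Fin 8`. -/
lemma sum_suppOn_star (g : Config E → ℚ) :
    (∑ a : Config E, if SuppOn {s0, s1, s2} a then g a else 0) = ∑ i : Fin 8, g (cfg s0 s1 s2 i) := by
  rw [← Finset.sum_filter]
  symm
  refine Finset.sum_nbij' (fun i => cfg s0 s1 s2 i) (fun a => bits s0 s1 s2 a) ?_ ?_ ?_ ?_ ?_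
  · intro i _
    simp only [Finset.mem_filter, Finset.mem_univ, true_and]
    exact suppOn_cfg s0 s1 s2 i
  · intro a _
    exact Finset.mem_univ _
  · intro i _
    exact bits_cfg s0 s1 s2 h01 h02 h12 i
  · intro a ha
    simp only [Finset.mem_filter, Finset.mem_univ, true_and] at ha
    exact cfg_bits s0 s1 s2 h01 h02 h12 ha
  · intro i _
    rfl

include h01 h02 h12 in
omit [Fintype E] in
/-- The open counts of star configurations on the star edges are the bit sums. -/
lemma openCount_cfg (i j k : Fin 8) :
    openCount (cfg s0 s1 s2 i) (cfg s0 s1 s2 j) (cfg s0 s1 s2 k) s0 = bit 0 i + bit 0 j + bit 0 k ∧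
    openCount (cfg s0 s1 s2 i) (cfg s0 s1 s2 j) (cfg s0 s1 s2 k) s1 = bit 1 i + bit 1 j + bit 1 k ∧
    openCount (cfg s0 s1 s2 i) (cfg s0 s1 s2 j) (cfg s0 s1 s2 k) s2 = bit 2 i + bit 2 j + bit 2 k := by
  simp only [openCount, cfg_s0, cfg_s1 s0 s1 s2 h01, cfg_s2 s0 s1 s2 h02 h12, toNat_decide_bit, and_self]

include h01 h02 h12 in
omit [Fintype E] in
/-- The `(2,2,2)` condition on the star is `typed8`. -/
lemma typed_iff (τ : E → ℕ) (hτ0 : τ s0 = 2) (hτ1 : τ s1 = 2) (hτ2 : τ s2 = 2) (i j k : Fin 8) :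
    (∀ e ∈ ({s0, s1, s2} : Finset E),
        openCount (cfg s0 s1 s2 i) (cfg s0 s1 s2 j) (cfg s0 s1 s2 k) e = τ e) ↔ typed8 i j k := by
  obtain ⟨e0, e1, e2⟩ := openCount_cfg s0 s1 s2 h01 h02 h12 i j k
  simp only [Finset.mem_insert, Finset.mem_singleton, forall_eq_or_imp, forall_eq, e0, e1, e2, hτ0, hτ1,
    hτ2, typed8]

/-- The per-copy pinned table of the core on the star's configurations, as a cubic on `Fin 8 → ℚ`. -/
def tableCubic (F : Finset E) (z : Config E) (τ : E → ℕ) (K : Config E → Config E → Config E → ℚ) :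
    (Fin 8 → ℚ) → ℚ :=
  fun μ => ∑ i : Fin 8, ∑ j : Fin 8, ∑ k : Fin 8,
    typedCount3 F (setOn {s0, s1, s2} (cfg s0 s1 s2 i) z) (setOn {s0, s1, s2} (cfg s0 s1 s2 j) z)
      (setOn {s0, s1, s2} (cfg s0 s1 s2 k) z) τ K * mono8 i j k μ

include h01 h02 h12 in
/-- **The typed `(2,2,2)`-star base from the cone**: if the core's per-copy pinned table lies in the
Harris cone of the star world, the typed count of core + star at types `2` on the star is nonnegative. -/
theorem typedCount_star222_nonneg (F : Finset E) (hF0 : s0 ∉ F) (hF1 : s1 ∉ F) (hF2 : s2 ∉ F)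
    (z : Config E) (τ : E → ℕ) (hτ0 : τ s0 = 2) (hτ1 : τ s1 = 2) (hτ2 : τ s2 = 2)
    (K : Config E → Config E → Config E → ℚ) (hcone : InCone8 (tableCubic s0 s1 s2 F z τ K)) :
    0 ≤ typedCount (F ∪ {s0, s1, s2}) z τ K := by
  have hd : Disjoint F {s0, s1, s2} := by
    rw [Finset.disjoint_right]
    intro e he
    simp only [Finset.mem_insert, Finset.mem_singleton] at he
    rcases he with rfl | rfl | rfl <;> assumption
  rw [typedCount_split hd]
  simp only [and_assoc, ite_and_left, ← ite_sum]
  rw [sum_suppOn_star s0 s1 s2 h01 h02 h12]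
  have h2 : ∀ i : Fin 8, (∑ b : Config E, if SuppOn {s0, s1, s2} b then ∑ c : Config E,
      if SuppOn {s0, s1, s2} c then
        (if (∀ e ∈ ({s0, s1, s2} : Finset E), openCount (cfg s0 s1 s2 i) b c e = τ e) then
          typedCount3 F (setOn {s0, s1, s2} (cfg s0 s1 s2 i) z) (setOn {s0, s1, s2} b z)
            (setOn {s0, s1, s2} c z) τ K else 0) else 0 else 0) =
      ∑ j : Fin 8, ∑ k : Fin 8, if typed8 i j k then
        typedCount3 F (setOn {s0, s1, s2} (cfg s0 s1 s2 i) z) (setOn {s0, s1, s2} (cfg s0 s1 s2 j) z)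
          (setOn {s0, s1, s2} (cfg s0 s1 s2 k) z) τ K else 0 := by
    intro i
    rw [sum_suppOn_star s0 s1 s2 h01 h02 h12]
    refine Finset.sum_congr rfl fun j _ => ?_
    rw [sum_suppOn_star s0 s1 s2 h01 h02 h12]
    refine Finset.sum_congr rfl fun k _ => ?_
    simp only [typed_iff s0 s1 s2 h01 h02 h12 τ hτ0 hτ1 hτ2]
  simp only [h2]
  have hstar : (∑ i : Fin 8, ∑ j : Fin 8, ∑ k : Fin 8, if typed8 i j k then
      typedCount3 F (setOn {s0, s1, s2} (cfg s0 s1 s2 i) z) (setOn {s0, s1, s2} (cfg s0 s1 s2 j) z)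
        (setOn {s0, s1, s2} (cfg s0 s1 s2 k) z) τ K else 0) = star8 (tableCubic s0 s1 s2 F z τ K) := by
    unfold tableCubic
    rw [star8_sum]
    refine Finset.sum_congr rfl fun i _ => ?_
    rw [star8_sum]
    refine Finset.sum_congr rfl fun j _ => ?_
    rw [star8_sum]
    refine Finset.sum_congr rfl fun k _ => ?_
    rw [star8_smul, star8_mono8]
    split_ifs <;> simp
  rw [hstar]
  exact star8_nonneg_of_inCone8 _ hcone

end Star

end TypedStar

end Summit.Ventures.PercRepro2
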